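import Mathlib
import Summits.Ventures.HodgeRepro.Tier4.Common.Automorphic

/-!
# Tier4/Common/Spectral — the `U(W)`-side spectral data of the Tier-4 datum and the bridge to night-2's
`SpectralInterface` / `SeesawComponents` ((P) ⟺ (P′))

Blind re-derivation cell `pub-hodge-repro`, Tier 4 (README §9–§10), seat t4-typer-2 (gen 0).  Target tree path
`lean/Summits/Ventures/HodgeRepro/Tier4/Common/Spectral.lean`.  Imports `Tier4/Common/Automorphic.lean`
(`ThetaLifts`, `EndoscopicSide`, `toC7Face`, `toC7Face_P`); the night-2 vocabulary comes through it
(`PeriodCloserC7Identification`: `SpectralInterface I`, `SpectralDecomposition`, `TermFactors`, `HeckeIsolation`,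
`RallisNonvanishing`, `IsolateTerm`, `SeesawComponents`, `P_of_P'_of_components`, `P'_of_P_of_components`).
Asked by t4-plan-1 (L1, S11892: «`SpectralInterface E.toC7Face` built on the datum»).

WHAT IS TYPED.  `SpectralSide E`: for a choice of translates `γ`, the finitely many `τ ⊂ L²([U(W)])` through which
the kernel of the datum passes at its level (`[U(W)]` compact, the spectrum discrete, the kernel `K`-finite) and the
`τ`-term `⟨θ_{W,V}(v_τ), θ_{W′,V}(v′_τ)⟩_{L²(X)}` of the Hodge pairing.  `E.toSpectral S : SpectralInterface
E.toC7Face` is night-2's interface on the Tier-4 datum; the components (S1)–(S3) unfold on `W.Translates` /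
`W.hodgePairing` (`spectralDecomposition_iff`, `termFactors_iff`, `heckeIsolation_iff`, `rallisNonvanishing_iff`),
(P′) unfolds to its atoms (`P'_iff`), and the landed seesaw assembly transports to the sentence:
**`Witness.P_of_P'_of_seesaw : SeesawComponents … → E.toC7Face.P' → W.P`**, `Witness.P'_of_P_of_seesaw`,
`Witness.P_iff_P'_of_seesaw`.  Every field is a parameter; nothing here says anything about the status of the
Hodge conjecture for CM abelian varieties, which is NOT proved (HC_CM is NOT proved by anyone in this repository).
-/

set_option autoImplicit false

noncomputable section

namespace Summit.Ventures.HodgeRepro.Tier4.Common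

open NumberField PeriodCloser

variable {L : Type} [Field L] [NumberField L] [IsCMField L]
  {Form : Type} [AddCommGroup Form] [Module ℂ Form] {A : FormAlgebra Form} {W : Witness A}
  {Θ : ThetaLifts W}

/-- **The spectral side of the datum**: the finite spectrum `{τ ⊂ L²([U(W)])}` of a choice of translates at its
level and the `τ`-term of its Hodge pairing. -/
structure SpectralSide (E : EndoscopicSide L W Θ) where
  /-- the `τ` with a non-zero `K`-fixed vector at the level of the choice -/
  spectrum : W.Translates → Finset E.Tau
  /-- the `τ`-term `⟨θ_{W,V}(v_τ), θ_{W′,V}(v′_τ)⟩_{L²(X)}` of the Hodge pairing of the choice -/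
  tauPairing : W.Translates → E.Tau → ℂ

namespace EndoscopicSide

variable (E : EndoscopicSide L W Θ) (S : SpectralSide E)

/-- Night-2's spectral interface on the Tier-4 datum. -/
def toSpectral : SpectralInterface E.toC7Face where
  spectrum := S.spectrum
  tauPairing := S.tauPairing

/-- (S1) on the datum: `⟨f^*Ω_s, f^*Ω_{s̄}⟩ = Σ_{τ ∈ spectrum γ} (τ-term)`. -/
theorem spectralDecomposition_iff :
    SpectralDecomposition E.toC7Face (E.toSpectral S) ↔
      ∀ γ : W.Translates, W.hodgePairing γ = ∑ τ ∈ S.spectrum γ, S.tauPairing γ τ :=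
  Iff.rfl

/-- (S2) on the datum: a non-zero `τ`-term forces both toric periods and the lift. -/
theorem termFactors_iff :
    TermFactors E.toC7Face (E.toSpectral S) ↔
      ∀ (γ : W.Translates) (τ : E.Tau), S.tauPairing γ τ ≠ 0 →
        (∀ i : Fin 2, E.toricPeriodNonzero i γ τ) ∧ E.liftNonzero τ :=
  Iff.rfl

/-- (S3a) on the datum: a `τ` carrying both toric periods is isolated by some choice of translates. -/
theorem heckeIsolation_iff :
    HeckeIsolation E.toC7Face (E.toSpectral S) ↔
      ∀ (γ : W.Translates) (τ : E.Tau), (∀ i : Fin 2, E.toricPeriodNonzero i γ τ) →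
        ∃ γ' : W.Translates, S.spectrum γ' = {τ} ∧ ∀ i : Fin 2, E.toricPeriodNonzero i γ' τ :=
  Iff.rfl

/-- (S3b) on the datum: an isolated `τ` with both toric periods and a non-zero lift has a non-zero term for some
choice. -/
theorem rallisNonvanishing_iff :
    RallisNonvanishing E.toC7Face (E.toSpectral S) ↔
      ∀ (γ : W.Translates) (τ : E.Tau), S.spectrum γ = {τ} → (∀ i : Fin 2, E.toricPeriodNonzero i γ τ) →
        E.liftNonzero τ → ∃ γ' : W.Translates, S.spectrum γ' = {τ} ∧ S.tauPairing γ' τ ≠ 0 :=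
  Iff.rfl

/-- **(P′) on the datum**: some choice of translates and some `τ` with both toric periods non-zero and a non-zero
lift to `V`. -/
theorem P'_iff :
    E.toC7Face.P' ↔ ∃ (γ : W.Translates) (τ : E.Tau), (∀ i : Fin 2, E.toricPeriodNonzero i γ τ) ∧ E.liftNonzero τ :=
  Iff.rfl

end EndoscopicSide

namespace Witness

variable (E : EndoscopicSide L W Θ) (S : SpectralSide E)

/-- **(P′) ⟹ (P)** on the Tier-4 datum, from the seesaw components (S1)–(S3) (night-2's `P_of_P'_of_components`). -/
theorem P_of_P'_of_seesaw (H : SeesawComponents E.toC7Face (E.toSpectral S)) (hP' : E.toC7Face.P') : W.P :=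
  E.toC7Face_P.mp (P_of_P'_of_components E.toC7Face (E.toSpectral S) H hP')

/-- **(P) ⟹ (P′)** on the Tier-4 datum, from the seesaw components. -/
theorem P'_of_P_of_seesaw (H : SeesawComponents E.toC7Face (E.toSpectral S)) (hP : W.P) : E.toC7Face.P' :=
  P'_of_P_of_components E.toC7Face (E.toSpectral S) H (E.toC7Face_P.mpr hP)

/-- **(P) ⟺ (P′)** on the Tier-4 datum, from the seesaw components. -/
theorem P_iff_P'_of_seesaw (H : SeesawComponents E.toC7Face (E.toSpectral S)) : W.P ↔ E.toC7Face.P' :=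
  ⟨P'_of_P_of_seesaw E S H, P_of_P'_of_seesaw E S H⟩

/-- (P) from (P′) and the seesaw form alone (`Identification.seesaw`), without the components. -/
theorem P_of_P' (hseesaw : E.toC7Face.P ↔ E.toC7Face.P') (hP' : E.toC7Face.P') : W.P :=
  E.toC7Face_P.mp (hseesaw.mpr hP')

end Witness

end Summit.Ventures.HodgeRepro.Tier4.Common

end
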